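import Mathlib.Tactic
import HarnessLib
import HarnessLib.Audit.Tags
import Summits.CriticalPhenomena.PercolationContinuityZ3.Theorems.PercNearOneGluingNoHeavyLowerTailSahiAntichainSplitSeven
import Summits.CriticalPhenomena.PercolationContinuityZ3.Theorems.PercNearOneGluingNoHeavyLowerTailSahiAntichainFourSeven

/-!
# Antichains, meets plus joins: two members above a five-label triple — the two structural lemmas for statement (F)

Support file (seat `prim-masterthm-p1`, gen 37; `--supports stmt-CriticalPhenomena-4575`).  No `sorry`, no new definitions, standard
axioms.  Memo `run/shared/lean/prim/prim-masterthm/FROM-prim-masterthm-p1-g37-LINEAR-REDUCTION.md` §8.5/§9.1.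

SETTING: L3 (`f(5) ≥ 10`) ⟸ H23 ⟸ (S), (C), (F) (`h23_of`, `…TwoThreeA`).  Statement (F) concerns a point with exactly two members
above and three members below that form neither a sunflower nor a co-sunflower and have at most five labels of their own: if no cross
meet is new then at least three cross joins are new.  This file proves the two structural lemmas; `…TwoThreeF` assembles (F).

STRUCTURE.  Such a triple has `(#meets, #joins) ∈ {(3,2), (2,3)}`.  (i) Type (3,2), `b₁ ∪ b₂ = b₁ ∪ b₃`: then «no new meet» is impossible
already for ONE member `a` above (`newMeets_nonempty_of_union_eq`): with `N = b₂ \\ b₁ = b₃ \\ b₁ ≠ ∅`, `m₁₂ ⊄ b₃`, `m₁₃ ⊄ b₂`, `m₂₃ ⊄ b₁`, the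
old values force `a ∩ b₁ ∈ {m₁₂, m₁₃}`, `a ∩ b₂ ∈ {m₁₂, m₂₃}`, `a ∩ b₃ ∈ {m₁₃, m₂₃}` and each combination is contradictory.  (ii) Type (2,3),
`b₁ ∩ b₂ = b₁ ∩ b₃ = M ≠ M' = b₂ ∩ b₃`: then `M ⊊ M'`, both cross meets with `b₁` equal `M`, so `b₁ ⊄ a ∪ a'` and `(a △ a') ∩ b₁ = ∅`, giving the
two new distinct joins `a ∪ b₁, a' ∪ b₁`; a third comes from `b₂`/`b₃` (`three_le_card_newJoins_of_inter_eq`).  Complete atom census (memo §9.1):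
`newMeets = 0` happens at such points only in type (2,3), and then with `newJoins = 6`.
HONEST FRAMING: unconditional; with `…TwoThreeS/C/A` this closes H23 and L3 in the kernel once assembled; L4, V5 remain OPEN. [this work]
-/

namespace Summit.CriticalPhenomena.PercolationContinuityZ3.Theorems.SahiColouredDaykin

open Finset

variable {α : Type*} [DecidableEq α]

section TypeThreeTwo

variable {P : Finset (Finset α)} {r : α} {a b₁ b₂ b₃ : Finset α}

/-- **Type (3,2): a member above always has a new cross meet.**  Three distinct members `b₁, b₂, b₃` below (all of them) with
`b₁ ∪ b₂ = b₁ ∪ b₃`, and a member `a` above: some `a ∩ bⱼ` is new. [this work] -/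
theorem newMeets_nonempty_of_union_eq (hanti : IsAntichain (· ⊆ ·) (P : Set (Finset α)))
    (ha : a ∈ above P r) (h1 : b₁ ∈ below P r) (h2 : b₂ ∈ below P r) (h3 : b₃ ∈ below P r)
    (h12 : b₁ ≠ b₂) (h13 : b₁ ≠ b₃) (h23 : b₂ ≠ b₃) (hall : ∀ b ∈ below P r, b = b₁ ∨ b = b₂ ∨ b = b₃)
    (hW : b₁ ∪ b₂ = b₁ ∪ b₃) : (newMeets P r).Nonempty := by
  have P1 := below_subset P r h1
  have P2 := below_subset P r h2
  have P3 := below_subset P r h3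
  have n23 : ¬ b₂ ⊆ b₃ := hanti (mem_coe.2 P2) (mem_coe.2 P3) h23
  have n32 : ¬ b₃ ⊆ b₂ := hanti (mem_coe.2 P3) (mem_coe.2 P2) h23.symm
  have n21 : ¬ b₂ ⊆ b₁ := hanti (mem_coe.2 P2) (mem_coe.2 P1) h12.symm
  -- N = b₂ \ b₁ = b₃ \ b₁: a point `ν ∈ b₂, ∉ b₁`, hence `∈ b₃`
  obtain ⟨ν, hν2, hν1⟩ := not_subset.1 n21
  have hν3 : ν ∈ b₃ := by
    have : ν ∈ b₁ ∪ b₃ := by rw [← hW]; exact mem_union_right _ hν2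
    rcases mem_union.1 this with h | h
    · exact absurd h hν1
    · exact h
  -- points `p ∈ b₂ \ b₃` (inside `b₁`) and `q ∈ b₃ \ b₂` (inside `b₁`)
  obtain ⟨p, hp2, hp3⟩ := not_subset.1 n23
  obtain ⟨q, hq3, hq2⟩ := not_subset.1 n32
  have hp1 : p ∈ b₁ := by
    have : p ∈ b₁ ∪ b₃ := by rw [← hW]; exact mem_union_right _ hp2
    rcases mem_union.1 this with h | h
    · exact h
    · exact absurd h hp3
  have hq1 : q ∈ b₁ := by
    have : q ∈ b₁ ∪ b₂ := by rw [hW]; exact mem_union_right _ hq3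
    rcases mem_union.1 this with h | h
    · exact h
    · exact absurd h hq2
  by_contra hempty
  rw [not_nonempty_iff_eq_empty] at hempty
  -- every cross meet of `a` is one of the three meets
  have old : ∀ {b : Finset α}, b ∈ below P r →
      a ∩ b = b₁ ∩ b₂ ∨ a ∩ b = b₁ ∩ b₃ ∨ a ∩ b = b₂ ∩ b₃ := by
    intro b hb
    have hmem : a ∩ b ∈ meets (below P r) := by
      by_contra hnot
      have : a ∩ b ∈ newMeets P r := (inter_mem_newMeets_iff ha hb).2 hnot
      rw [hempty] at this; exact absurd this (notMem_empty _)
    obtain ⟨d, hd, d', hd', hdd', heq⟩ := mem_meets_iff.1 hmem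
    rcases hall d hd with rfl | rfl | rfl <;> rcases hall d' hd' with rfl | rfl | rfl
    · exact absurd rfl hdd'
    · exact Or.inl heq
    · exact Or.inr (Or.inl heq)
    · exact Or.inl (by rw [heq, inter_comm])
    · exact absurd rfl hdd'
    · exact Or.inr (Or.inr heq)
    · exact Or.inr (Or.inl (by rw [heq, inter_comm]))
    · exact Or.inr (Or.inr (by rw [heq, inter_comm]))
    · exact absurd rfl hdd'
  -- exclusions by the witness points
  have e1 : a ∩ b₁ ≠ b₂ ∩ b₃ := by
    intro h; have : ν ∈ a ∩ b₁ := by rw [h]; exact mem_inter.2 ⟨hν2, hν3⟩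
    exact hν1 (mem_inter.1 this).2
  have e2 : a ∩ b₂ ≠ b₁ ∩ b₃ := by
    intro h; have : q ∈ a ∩ b₂ := by rw [h]; exact mem_inter.2 ⟨hq1, hq3⟩
    exact hq2 (mem_inter.1 this).2
  have e3 : a ∩ b₃ ≠ b₁ ∩ b₂ := by
    intro h; have : p ∈ a ∩ b₃ := by rw [h]; exact mem_inter.2 ⟨hp1, hp2⟩
    exact hp3 (mem_inter.1 this).2
  rcases old h2 with h2v | h2v | h2v
  · -- (β) `a ∩ b₂ = m₁₂`; then `a ∩ b₃ = m₁₃` (if it were `m₂₃`, `ν ∈ a`, so `ν ∈ a ∩ b₂ = m₁₂ ⊆ b₁`)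
    rcases old h3 with h3v | h3v | h3v
    · exact e3 h3v
    · -- `a ⊇ m₁₂ ∪ m₁₃`; `a ∩ b₁ ∈ {m₁₂, m₁₃}` contains both `p` and `q`
      have hpa : p ∈ a := by
        have : p ∈ a ∩ b₂ := by rw [h2v]; exact mem_inter.2 ⟨hp1, hp2⟩
        exact (mem_inter.1 this).1
      have hqa : q ∈ a := by
        have : q ∈ a ∩ b₃ := by rw [h3v]; exact mem_inter.2 ⟨hq1, hq3⟩
        exact (mem_inter.1 this).1
      rcases old h1 with h1v | h1v | h1v
      · have : q ∈ b₁ ∩ b₂ := by rw [← h1v]; exact mem_inter.2 ⟨hqa, hq1⟩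
        exact hq2 (mem_inter.1 this).2
      · have : p ∈ b₁ ∩ b₃ := by rw [← h1v]; exact mem_inter.2 ⟨hpa, hp1⟩
        exact hp3 (mem_inter.1 this).2
      · exact e1 h1v
    · have hνa : ν ∈ a := by
        have : ν ∈ a ∩ b₃ := by rw [h3v]; exact mem_inter.2 ⟨hν2, hν3⟩
        exact (mem_inter.1 this).1
      have : ν ∈ b₁ ∩ b₂ := by rw [← h2v]; exact mem_inter.2 ⟨hνa, hν2⟩
      exact hν1 (mem_inter.1 this).1
  · exact e2 h2v
  · -- (α) `a ∩ b₂ = m₂₃`: `ν ∈ a`, so `a ∩ b₃ = m₂₃` as well; then `a ∩ b₁` can be neither `m₁₂` nor `m₁₃`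
    have hνa : ν ∈ a := by
      have : ν ∈ a ∩ b₂ := by rw [h2v]; exact mem_inter.2 ⟨hν2, hν3⟩
      exact (mem_inter.1 this).1
    -- `a` misses `p` (p ∈ b₂, p ∉ m₂₃) and `q`
    have hpa : p ∉ a := by
      intro hpa
      have : p ∈ b₂ ∩ b₃ := by rw [← h2v]; exact mem_inter.2 ⟨hpa, hp2⟩
      exact hp3 (mem_inter.1 this).2
    rcases old h3 with h3v | h3v | h3v
    · exact e3 h3v
    · have : ν ∈ b₁ ∩ b₃ := by rw [← h3v]; exact mem_inter.2 ⟨hνa, hν3⟩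
      exact hν1 (mem_inter.1 this).1
    · have hqa : q ∉ a := by
        intro hqa
        have : q ∈ b₂ ∩ b₃ := by rw [← h3v]; exact mem_inter.2 ⟨hqa, hq3⟩
        exact hq2 (mem_inter.1 this).1
      rcases old h1 with h1v | h1v | h1v
      · have : p ∈ a ∩ b₁ := by rw [h1v]; exact mem_inter.2 ⟨hp1, hp2⟩
        exact hpa (mem_inter.1 this).1
      · have : q ∈ a ∩ b₁ := by rw [h1v]; exact mem_inter.2 ⟨hq1, hq3⟩
        exact hqa (mem_inter.1 this).1
      · exact e1 h1v

end TypeThreeTwo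

section TypeTwoThree

variable {P : Finset (Finset α)} {r : α} {b₁ b₂ b₃ : Finset α}

/-- **Type (2,3): no new meet ⟹ three new joins.**  Two members above; three distinct members `b₁, b₂, b₃` below (all of them) with
`b₁ ∩ b₂ = b₁ ∩ b₃ ≠ b₂ ∩ b₃`; if no cross meet is new then `#newJoins ≥ 3`. [this work] -/
theorem three_le_card_newJoins_of_inter_eq (hanti : IsAntichain (· ⊆ ·) (P : Set (Finset α))) (hA2 : #(above P r) = 2)
    (h1 : b₁ ∈ below P r) (h2 : b₂ ∈ below P r) (h3 : b₃ ∈ below P r)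
    (h12 : b₁ ≠ b₂) (h13 : b₁ ≠ b₃) (h23 : b₂ ≠ b₃) (hall : ∀ b ∈ below P r, b = b₁ ∨ b = b₂ ∨ b = b₃)
    (hM : b₁ ∩ b₂ = b₁ ∩ b₃) (hMM : b₁ ∩ b₂ ≠ b₂ ∩ b₃) (h0 : newMeets P r = ∅) : 3 ≤ #(newJoins P r) := by
  obtain ⟨a, a', hne, hA⟩ := card_eq_two.1 hA2
  have ha : a ∈ above P r := by rw [hA]; simp
  have ha' : a' ∈ above P r := by rw [hA]; simp
  obtain ⟨haP, hra⟩ := mem_above_iff.1 ha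
  obtain ⟨ha'P, hra'⟩ := mem_above_iff.1 ha'
  have hJ : joins (above P r) = {a ∪ a'} := by rw [hA, joins_pair hne]
  have newJ : ∀ {g b : Finset α}, g ∈ above P r → b ∈ below P r → g ∪ b ≠ a ∪ a' → g ∪ b ∈ newJoins P r := by
    intro g b hg hb hne'
    rw [union_mem_newJoins_iff hg hb, hJ, mem_singleton]; exact hne'
  have P1 := below_subset P r h1
  have P2 := below_subset P r h2
  have P3 := below_subset P r h3
  set M := b₁ ∩ b₂ with hMdef
  set M' := b₂ ∩ b₃ with hM'def
  -- `M ⊆ M'` and a point `μ ∈ M' \ b₁`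
  have hMM' : M ⊆ M' := by
    intro x hx
    have hx3 : x ∈ b₃ := by
      have : x ∈ b₁ ∩ b₃ := by rw [← hM]; exact hx
      exact (mem_inter.1 this).2
    exact mem_inter.2 ⟨(mem_inter.1 hx).2, hx3⟩
  have hμ : ∃ μ ∈ M', μ ∉ b₁ := by
    by_contra hnone
    push Not at hnone
    apply hMM
    apply Subset.antisymm hMM'
    intro x hx
    exact mem_inter.2 ⟨hnone x hx, (mem_inter.1 hx).1⟩
  obtain ⟨μ, hμM', hμ1⟩ := hμ
  have hμ2 : μ ∈ b₂ := (mem_inter.1 hμM').1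
  have hμ3 : μ ∈ b₃ := (mem_inter.1 hμM').2
  -- every cross meet is `M` or `M'`
  have old : ∀ {g b : Finset α}, g ∈ above P r → b ∈ below P r → g ∩ b = M ∨ g ∩ b = M' := by
    intro g b hg hb
    have hmem : g ∩ b ∈ meets (below P r) := by
      by_contra hnot
      have : g ∩ b ∈ newMeets P r := (inter_mem_newMeets_iff hg hb).2 hnot
      rw [h0] at this; exact absurd this (notMem_empty _)
    obtain ⟨d, hd, d', hd', hdd', heq⟩ := mem_meets_iff.1 hmem
    rcases hall d hd with rfl | rfl | rfl <;> rcases hall d' hd' with rfl | rfl | rfl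
    · exact absurd rfl hdd'
    · exact Or.inl heq
    · exact Or.inl (heq.trans hM.symm)
    · exact Or.inl (by rw [heq, inter_comm])
    · exact absurd rfl hdd'
    · exact Or.inr heq
    · exact Or.inl (by rw [heq, inter_comm, ← hM])
    · exact Or.inr (by rw [heq, inter_comm])
    · exact absurd rfl hdd'
  -- cross meets with `b₁` are `M` (as `M' ⊄ b₁`)
  have m1 : ∀ {g : Finset α}, g ∈ above P r → g ∩ b₁ = M := by
    intro g hg
    rcases old hg h1 with h | h
    · exact h
    · exfalso
      have : μ ∈ g ∩ b₁ := by rw [h]; exact hμM'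
      exact hμ1 (mem_inter.1 this).2
  -- `b₁ ⊄ a ∪ a'` (witness: a point of `b₁` outside `M`... via `b₁ ⊄ b₂`), and `a △ a'` misses `b₁`
  have n12 : ¬ b₁ ⊆ b₂ := hanti (mem_coe.2 P1) (mem_coe.2 P2) h12
  obtain ⟨π, hπ1, hπ2⟩ := not_subset.1 n12
  have hπu : π ∉ a ∪ a' := by
    intro h
    rcases mem_union.1 h with h | h
    · have : π ∈ M := by rw [← m1 ha]; exact mem_inter.2 ⟨h, hπ1⟩
      exact hπ2 (mem_inter.1 this).2
    · have : π ∈ M := by rw [← m1 ha']; exact mem_inter.2 ⟨h, hπ1⟩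
      exact hπ2 (mem_inter.1 this).2
  have Dmiss : ∀ {x}, x ∈ b₁ → x ∈ a → x ∈ a' := by
    intro x hx1 hxa
    have : x ∈ M := by rw [← m1 ha]; exact mem_inter.2 ⟨hxa, hx1⟩
    have : x ∈ a' ∩ b₁ := by rw [m1 ha']; exact this
    exact (mem_inter.1 this).1
  have Dmiss' : ∀ {x}, x ∈ b₁ → x ∈ a' → x ∈ a := by
    intro x hx1 hxa'
    have : x ∈ M := by rw [← m1 ha']; exact mem_inter.2 ⟨hxa', hx1⟩
    have : x ∈ a ∩ b₁ := by rw [m1 ha]; exact this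
    exact (mem_inter.1 this).1
  have naa' : ¬ a ⊆ a' := hanti (mem_coe.2 haP) (mem_coe.2 ha'P) hne
  have na'a : ¬ a' ⊆ a := hanti (mem_coe.2 ha'P) (mem_coe.2 haP) hne.symm
  obtain ⟨s, hsa, hsa'⟩ := not_subset.1 naa'
  obtain ⟨t, hta', hta⟩ := not_subset.1 na'a
  -- the two new joins through `b₁`
  have W1 : a ∪ b₁ ∈ newJoins P r := newJ ha h1 (fun h => hπu (by rw [← h]; exact mem_union_right _ hπ1))
  have W1' : a' ∪ b₁ ∈ newJoins P r := newJ ha' h1 (fun h => hπu (by rw [← h]; exact mem_union_right _ hπ1))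
  have hW11 : a ∪ b₁ ≠ a' ∪ b₁ := by
    intro h
    have : s ∈ a' ∪ b₁ := by rw [← h]; exact mem_union_left _ hsa
    rcases mem_union.1 this with h' | h'
    · exact hsa' h'
    · exact hsa' (Dmiss h' hsa)
  -- a third new join, with two others, gives the claim
  have third : ∀ {W : Finset α}, W ∈ newJoins P r → W ≠ a ∪ b₁ → W ≠ a' ∪ b₁ → 3 ≤ #(newJoins P r) := by
    intro W hW hW1 hW2
    have hsub : ({W, a ∪ b₁, a' ∪ b₁} : Finset (Finset α)) ⊆ newJoins P r := by
      intro x hx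
      simp only [mem_insert, mem_singleton] at hx
      rcases hx with rfl | rfl | rfl
      · exact hW
      · exact W1
      · exact W1'
    have hcard : #({W, a ∪ b₁, a' ∪ b₁} : Finset (Finset α)) = 3 := by
      rw [card_insert_of_notMem, card_pair hW11]
      simp only [mem_insert, mem_singleton, not_or]; exact ⟨hW1, hW2⟩
    calc 3 = #({W, a ∪ b₁, a' ∪ b₁} : Finset (Finset α)) := hcard.symm
      _ ≤ #(newJoins P r) := card_le_card hsub
  -- (H1) `g ∪ bⱼ ≠ g ∪ b₁` for `j = 2, 3`: a point of `b₁ \ bⱼ` in `g` would lie in `g ∩ b₁ = M ⊆ bⱼ`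
  have n13 : ¬ b₁ ⊆ b₃ := hanti (mem_coe.2 P1) (mem_coe.2 P3) h13
  obtain ⟨π', hπ'1, hπ'3⟩ := not_subset.1 n13
  have hM2 : M ⊆ b₂ := inter_subset_right
  have hM3 : M ⊆ b₃ := fun x hx => by
    have : x ∈ b₁ ∩ b₃ := by rw [← hM]; exact hx
    exact (mem_inter.1 this).2
  have H1 : ∀ {g c : Finset α} {x : α}, g ∈ above P r → x ∈ b₁ → x ∉ c → M ⊆ c → g ∪ c ≠ g ∪ b₁ := by
    intro g c x hg hx1 hxc hMc h
    have : x ∈ g ∪ c := by rw [h]; exact mem_union_right _ hx1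
    rcases mem_union.1 this with h' | h'
    · have : x ∈ M := by rw [← m1 hg]; exact mem_inter.2 ⟨h', hx1⟩
      exact hxc (hMc this)
    · exact hxc h'
  -- (H2) `g ∪ c ≠ g' ∪ b₁` for the other member `g'`: a point of `g \ g'` would lie in `b₁`, hence in `g ∩ b₁ = M = g' ∩ b₁ ⊆ g'`
  have H2 : ∀ {g g' c : Finset α} {z : α}, g ∈ above P r → g' ∈ above P r → z ∈ g → z ∉ g' → g ∪ c ≠ g' ∪ b₁ := by
    intro g g' c z hg hg' hzg hzg' h
    have : z ∈ g' ∪ b₁ := by rw [← h]; exact mem_union_left _ hzg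
    rcases mem_union.1 this with h' | h'
    · exact hzg' h'
    · have : z ∈ M := by rw [← m1 hg]; exact mem_inter.2 ⟨hzg, h'⟩
      have : z ∈ g' ∩ b₁ := by rw [m1 hg']; exact this
      exact hzg' (mem_inter.1 this).1
  -- (H3) a row meeting `b₂` in `M'` yields a third new join among `g ∪ b₂`, `g ∪ b₃`
  have rowM' : ∀ {g g' : Finset α} {z : α}, g ∈ above P r → g' ∈ above P r → z ∈ g → z ∉ g' → a ∪ a' = g ∪ g' ∨ a ∪ a' = g' ∪ g →
      g ∩ b₂ = M' → ∃ W ∈ newJoins P r, W ≠ g ∪ b₁ ∧ W ≠ g' ∪ b₁ := by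
    intro g g' z hg hg' hzg hzg' _ hv
    have hM'g : M' ⊆ g := by rw [← hv]; exact inter_subset_left
    have hv3 : g ∩ b₃ = M' := by
      rcases old hg h3 with h | h
      · exfalso
        have : μ ∈ g ∩ b₃ := mem_inter.2 ⟨hM'g hμM', hμ3⟩
        rw [h] at this; exact hμ1 ((mem_inter.1 this).1)
      · exact h
    have hne23 : g ∪ b₂ ≠ g ∪ b₃ := fun h => h23 (eq_of_inter_eq_of_union_eq (hv.trans hv3.symm) h)
    -- at most one of them is `u`
    by_cases hu2 : g ∪ b₂ = a ∪ a'
    · have hu3 : g ∪ b₃ ≠ a ∪ a' := fun h => hne23 (hu2.trans h.symm)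
      exact ⟨g ∪ b₃, newJ hg h3 hu3, H1 hg hπ'1 hπ'3 hM3, H2 hg hg' hzg hzg'⟩
    · exact ⟨g ∪ b₂, newJ hg h2 hu2, H1 hg hπ1 hπ2 hM2, H2 hg hg' hzg hzg'⟩
  rcases old ha h2 with hv | hv
  · rcases old ha' h2 with hv' | hv'
    · -- both rows meet `b₂` in `M`: `μ ∉ a ∪ a'`, so `a ∪ b₂` is new
      have hμa : μ ∉ a := by
        intro h; have : μ ∈ M := by rw [← hv]; exact mem_inter.2 ⟨h, hμ2⟩
        exact hμ1 ((mem_inter.1 this).1)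
      have hμa' : μ ∉ a' := by
        intro h; have : μ ∈ M := by rw [← hv']; exact mem_inter.2 ⟨h, hμ2⟩
        exact hμ1 ((mem_inter.1 this).1)
      have hnew : a ∪ b₂ ∈ newJoins P r := by
        refine newJ ha h2 (fun h => ?_)
        have : μ ∈ a ∪ a' := by rw [← h]; exact mem_union_right _ hμ2
        rcases mem_union.1 this with h' | h'
        · exact hμa h'
        · exact hμa' h'
      exact third hnew (H1 ha hπ1 hπ2 hM2) (H2 ha ha' hsa hsa')
    · obtain ⟨W, hW, hW1, hW2⟩ := rowM' ha' ha hta' hta (Or.inr rfl) hv'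
      exact third hW hW2 hW1
  · obtain ⟨W, hW, hW1, hW2⟩ := rowM' ha ha' hsa hsa' (Or.inl rfl) hv
    exact third hW hW1 hW2

end TypeTwoThree


end Summit.CriticalPhenomena.PercolationContinuityZ3.Theorems.SahiColouredDaykin
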